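import Mathlib.Algebra.MvPolynomial.PDeriv
import Mathlib.RingTheory.MvPolynomial.Basic
import Mathlib.Algebra.CharP.Two
import Mathlib.Algebra.BigOperators.Fin
import HarnessLib

/-!
# Second polars vanish in characteristic 2
# (crux `TeissierJung.TeissierReduction`, stmt-ResolutionOfSingularities-17085, line `Sketch`,
# card `codim-one-residual-separability`)

For a polynomial `F` in `n` variables over a commutative ring `k` of characteristic `2` and a centre
`O : Fin n → k`, the formal polar `D_O := Σᵢ Oᵢ ∂ᵢ` satisfies `D_O (D_O F) = 0`: the pure second
partials `∂ᵢ ∂ᵢ F` vanish (`∂ᵢ² xᵢ^m = m (m - 1) xᵢ^{m-2}` and `m (m - 1)` is even), and the mixed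
ones come in pairs `(i, j)`, `(j, i)` of equal value (`∂ᵢ ∂ⱼ = ∂ⱼ ∂ᵢ`), which cancel in
characteristic `2`.
This is the algebraic reason why every LINEAR projection of a hypersurface `V(F)` from a centre is
"ferocious" along its whole branch divisor in characteristic `2`.

* `pderiv_pderiv_comm` (private, folklore) — `∂ᵢ ∂ⱼ p = ∂ⱼ ∂ᵢ p` over any commutative semiring;
* `pderiv_pderiv_self_eq_zero` — `∂ᵢ ∂ᵢ p = 0` in characteristic `2`;
* `stub_secondPolar` — `Σᵢ Oᵢ ∂ᵢ (Σⱼ Oⱼ ∂ⱼ F) = 0` in characteristic `2`.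

Pure Mathlib algebra (`MvPolynomial.pderiv`, `Finset.sum_ninvolution`, `CharTwo.add_self_eq_zero`);
no named facts.
-/

-- single-problem summit: the doubled namespace component `ResolutionOfSingularities` is forced
set_option linter.dupNamespace false

noncomputable section

open MvPolynomial

namespace Summit.ResolutionOfSingularities.ResolutionOfSingularities.Theorems.TeissierReduction

/-- Partial derivatives of polynomials commute: `∂ᵢ ∂ⱼ p = ∂ⱼ ∂ᵢ p` (any commutative semiring of
coefficients, any index type); by induction on `p` through `C a`, sums and `p * X k`. Folklore; the
same 6-line induction is in tree over `ℝ` (`Literature/Algebra/Polynomial/FischerInnerProduct.lean`)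
and, verbatim over a general semiring, as `PolarPersistence.pderiv_pderiv_comm` of the
`ValiantsHypothesis` summit — kept `private` here rather than importing that analysis-heavy file
across summits for one folklore identity. -/
private theorem pderiv_pderiv_comm {σ R : Type*} [CommSemiring R] (i j : σ) (p : MvPolynomial σ R) :
    pderiv i (pderiv j p) = pderiv j (pderiv i p) := by
  classical
  induction p using MvPolynomial.induction_on with
  | C a => simp
  | add p q hp hq => simp [map_add, hp, hq]
  | mul_X p k h =>
    simp only [pderiv_mul, map_add, h, pderiv_X]
    by_cases hik : i = k <;> by_cases hjk : j = k <;> simp [hik, hjk]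

/-- In characteristic `2` every pure second partial derivative of a polynomial vanishes:
`∂ᵢ ∂ᵢ p = 0` (on monomials `∂ᵢ² xᵢ^m = m (m - 1) xᵢ^{m-2}` with `m (m - 1)` even; here by induction
on `p`, the Leibniz rule for `p * X i` producing the cross term `∂ᵢ p` twice). -/
theorem pderiv_pderiv_self_eq_zero {σ R : Type*} [CommSemiring R] [CharP R 2] (i : σ)
    (p : MvPolynomial σ R) : pderiv i (pderiv i p) = 0 := by
  induction p using MvPolynomial.induction_on with
  | C a => simp
  | add p q hp hq => simp [map_add, hp, hq]
  | mul_X p k h =>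
    by_cases hik : i = k
    · subst hik
      simp only [pderiv_mul, pderiv_X_self, mul_one, map_add, h, zero_mul, zero_add]
      exact CharTwo.add_self_eq_zero _
    · simp only [pderiv_mul, pderiv_X_of_ne (Ne.symm hik), mul_zero, add_zero, h, zero_mul]

/-- **Second polars vanish in characteristic 2** (STUB `stub_secondPolar` of line `Sketch`, card
`codim-one-residual-separability`). For `F ∈ k[x₁, …, xₙ]`, `k` a commutative ring of
characteristic `2`, and any centre `O`, the iterated formal polar
`D_O (D_O F) = Σᵢ Oᵢ ∂ᵢ (Σⱼ Oⱼ ∂ⱼ F)` is `0`: after expanding to `Σ_{(i,j)} Oᵢ Oⱼ ∂ᵢ ∂ⱼ F`, the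
involution `(i, j) ↦ (j, i)` pairs terms of equal value (`pderiv_pderiv_comm`), each pair summing to
`0` in characteristic `2`, and its fixed points, the diagonal terms, vanish by
`pderiv_pderiv_self_eq_zero` (`Finset.sum_ninvolution`). -/
theorem stub_secondPolar (k : Type) [CommRing k] [CharP k 2] (n : ℕ) (F : MvPolynomial (Fin n) k)
    (O : Fin n → k) :
    (∑ i : Fin n, O i • MvPolynomial.pderiv i
      (∑ j : Fin n, O j • MvPolynomial.pderiv j F)) = 0 := by
  have expand : ∀ i : Fin n, O i • pderiv i (∑ j : Fin n, O j • pderiv j F) =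
      ∑ j : Fin n, (O i * O j) • pderiv i (pderiv j F) := fun i => by
    rw [map_sum, Finset.smul_sum]
    exact Finset.sum_congr rfl fun j _ => by rw [Derivation.map_smul, smul_smul]
  simp_rw [expand]
  rw [← Fintype.sum_prod_type']
  refine Finset.sum_ninvolution Prod.swap ?_ ?_ (fun _ => Finset.mem_univ _) Prod.swap_swap
  · rintro ⟨i, j⟩
    simp only [Prod.swap_prod_mk]
    rw [pderiv_pderiv_comm j i F, mul_comm (O j) (O i)]
    exact CharTwo.add_self_eq_zero _
  · rintro ⟨i, j⟩ hne h
    simp only [Prod.swap_prod_mk, Prod.mk.injEq] at h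
    obtain ⟨rfl, -⟩ := h
    exact hne (by simp only [pderiv_pderiv_self_eq_zero, smul_zero])

end Summit.ResolutionOfSingularities.ResolutionOfSingularities.Theorems.TeissierReduction

end
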